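import Summits.BirchSwinnertonDyer.BirchSwinnertonDyer.Theorems.GenusKolyvaginAtTwoGenusPrimitiveSupplyAtTwoTwistMasterFrame
import Summits.BirchSwinnertonDyer.BirchSwinnertonDyer.Theorems.GenusKolyvaginAtTwoGenusPrimitiveSupplyAtTwoArchimedeanFrame
import Summits.BirchSwinnertonDyer.BirchSwinnertonDyer.Theorems.GenusKolyvaginAtTwoGenusPrimitiveSupplyAtTwoTwistUnramifiedMenu
import HarnessLib

/-!
# Route `GenusKolyvaginAtTwo`, crux #2 `GenusPrimitiveSupplyAtTwo` (stmt-BirchSwinnertonDyer-22136):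
# Cor. 3.4 (i) with a single REAL `T`-place from the FIVE-row finite menu (the unramified semistable row at `v ∣ 2` included),
# unconditionally, over every number field

Width seat `bsd-line-gk2-p5` g12 (cell `bsd-f1-sign2`, SUPPLY lineage), file 44 of the series: sequel of `…TwistMasterFrame` (§97, ONE
identification with every local row and the frame), g11's `…TwistUnramifiedMenu` (§96, the five-row finite menu) and gk2-p4 g12's
`…ArchimedeanFrame` (§70–§72: the real-`T`-place laws for the framed canonical identification with the THREE-row finite menu).
THEOREMS ONLY (no definition, no named fact, no `sorry`, no local instance); helper `--supports stmt-BirchSwinnertonDyer-22136`;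
no item is closed; BSD is not proved by any of this.

WHAT. The real-`T`-place laws of `…ArchimedeanFrame` take every finite place on the menu {split | odd & good for both | odd & silent
for both}: at a place ABOVE `2` only the split row is available, so over `ℚ` they reach the cell's T-A row (`d ≡ 1 (mod 8)`) but not
T-A⁵ (`d ≡ 5 (mod 8)`, `W` good at `2`: Mazur's norm theorem). With §97's master datum the laws are re-run on the five-row menu:

* §98 `transport_twist_agree_off_inl_of_menu₅`, `transport_twist_agree_off_inr_of_menu₅` — agreement of `φ_* 𝓚_{Wd}` with `𝓚_W`
  off one real / one finite place from the FIVE-row finite menu (g11 `transport_twist_agree_inr_of_menu₅`) and the two-row infinite menu;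
* §99 **`natCard_selmerGroup_twist_mul_two_eq_of_menu₅_inl`** (DOWN), **`natCard_selmerGroup_twist_eq_mul_two_of_menu₅_inl`** (UP),
  **`natCard_selmerGroup_twist_shift_of_menu₅_inl`** (the dichotomy) — Cor. 3.4 (i) with `T = {w₀}` a REAL place (`w₀(Δ_W) > 0`,
  `d ∉ K_{w₀}²`), every finite place on the FIVE-row menu {split | `v ∤ 2` Tamagawa-odd both | `v ∤ 2` good both | `v ∤ 2` silent both |
  unramified semistable (any residue characteristic)}, every other infinite place split or `H¹ = 0` for both — UNCONDITIONAL (PT,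
  Tate χ and Kramer's congruence for the framed identification fed by tree theorems), every number field, every elliptic `W`, no
  Galois-image hypothesis. The cell's T-A⁵ / T-A⁵′ rows over `ℚ` follow in the sequel file `…ArchimedeanUnramifiedRowsHold`.

References: [MazurRubin2010] Thm. 2.7, Remark 2.4, Lemmas 2.9, 2.10 (i)–(v), 2.11, Prop. 3.3, Cor. 3.4 (i) (arXiv:0904.3709 pp. 7–10);
[Kramer1981] §2 Props. 1, 2 (a), 3, 6, Thm. 1; [KramerTunnell1982] §6 Lemma 6.1; [KlagsbrunMazurRubin2013] Thm. 3.9, Lemma 5.2;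
[MilneADT2006] I Thm. 2.8, 2.13, Lemma 3.3, Thm. 4.10.
-/

set_option linter.dupNamespace false -- tree convention: `Summit.BirchSwinnertonDyer.BirchSwinnertonDyer.Theorems` (summit = sub-problem)
set_option autoImplicit false

noncomputable section

open scoped Classical ContRepresentation

/-! ## §98 Agreement off one place from the FIVE-row finite menu -/

namespace Summit.BirchSwinnertonDyer.BirchSwinnertonDyer.Theorems.GenusKolyArch

open WeierstrassCurve Field NumberField IsDedekindDomain Function
open Literature.NumberTheory.EllipticCurves Literature.NumberTheory.GaloisRepresentations
open Literature.NumberTheory.EllipticCurves.DokchitserDokchitser2012 (T xT)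
open Literature.NumberTheory.GaloisRepresentations.IsNonarchimedeanLocalField (maxUnramified)
open Literature.NumberTheory.GaloisRepresentations.DiscreteGaloisModule (SelmerStructure)
open Literature.NumberTheory.GaloisCohomology
open Summit.BirchSwinnertonDyer.Rank1Residual.X11b.CongruentTransfer
open Summit.BirchSwinnertonDyer.BirchSwinnertonDyer.Theorems.GenusKolyTwistLocal
open Summit.BirchSwinnertonDyer.BirchSwinnertonDyer.Theorems.GenusKolyTwistTamagawa (transport_twist_agree_inl_of_menu)
open Summit.BirchSwinnertonDyer.BirchSwinnertonDyer.Theorems.SchneiderFreeAdditiveX3.PoitouTateReduction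
  (poitouTate_selmerStructure_duality_real_holds)

section Agree

variable {K : Type} [Field K] [NumberField K] (W : WeierstrassCurve K) [W.IsElliptic]

/-- **Agreement of `φ_* 𝓚_{Wd}` with `𝓚_W` OFF ONE REAL PLACE `w₀`, from the FIVE-row finite menu** (split | `v ∤ 2` with both
Tamagawa numbers odd | `v ∤ 2` good for both | `v ∤ 2` silent for both | unramified in `K(√d)` with `W` good or multiplicative-odd, any
residue characteristic) at every finite place and the two-row menu (split | `H¹ = 0` for both) at every infinite place `≠ w₀`, for an
identification `φ` carrying the split-place agreement `hsplit` and the unramified row `hunr` (§97).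
[cite: MazurRubin2010, Lemma 2.9, Lemma 2.10 (i), (ii), (iii), (iv), (v)] -/
theorem transport_twist_agree_off_inl_of_menu₅ {Wd : WeierstrassCurve K} [Wd.IsElliptic] {d : K}
    (φ : (Wd.torsionGaloisModule ((2 : ℕ) : ℤ)).toContRepresentation →ⁱL
      (W.torsionGaloisModule ((2 : ℕ) : ℤ)).toContRepresentation)
    (ψ : (W.torsionGaloisModule ((2 : ℕ) : ℤ)).toContRepresentation →ⁱL
      (Wd.torsionGaloisModule ((2 : ℕ) : ℤ)).toContRepresentation)
    (hφψ : ∀ b, φ (ψ b) = b)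
    (hsplit : ∀ (E : Type) [Field E] [Algebra K E], (∃ s : E, s ^ 2 = algebraMap K E d) →
      (Wd.kummerLocalConditionAt ((2 : ℕ) : ℤ) E).map (galoisCohomology.map (φ.restrictField E) 1) =
        W.kummerLocalConditionAt ((2 : ℕ) : ℤ) E)
    (hunr : ∀ (v : HeightOneSpectrum (𝓞 K)),
      (W.HasGoodReductionAt v ∨ (W.HasMultiplicativeReductionAt v ∧ Odd (W.ordMinimalDiscriminant v))) →
      closureEmb (K := K) (v.adicCompletion K) (geomSqrt d) ∈ maxUnramified (v.adicCompletion K) →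
      (Wd.kummerLocalConditionAt ((2 : ℕ) : ℤ) (v.adicCompletion K)).map
          (galoisCohomology.map (φ.restrictField (v.adicCompletion K)) 1) =
        W.kummerLocalConditionAt ((2 : ℕ) : ℤ) (v.adicCompletion K))
    (𝓐 : SelmerStructure (W.torsionGaloisModule ((2 : ℕ) : ℤ)))
    (h𝓐 : ∀ v, 𝓐 v = (Wd.kummerSelmerStructure ((2 : ℕ) : ℤ) v).map
      (galoisCohomology.map (φ.restrictField (Place.Completion v)) 1))
    (w₀ : InfinitePlace K)
    (hfin : ∀ v : HeightOneSpectrum (𝓞 K),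
      (∃ s : v.adicCompletion K, s ^ 2 = algebraMap K (v.adicCompletion K) d) ∨
      (((2 : ℕ) : 𝓞 K) ∉ v.asIdeal ∧
        ¬ 2 ∣ (W.baseChange (v.adicCompletion K)).localTamagawaNumber (v.adicCompletionIntegers K) ∧
        ¬ 2 ∣ (Wd.baseChange (v.adicCompletion K)).localTamagawaNumber (v.adicCompletionIntegers K)) ∨
      (((2 : ℕ) : 𝓞 K) ∉ v.asIdeal ∧ W.HasGoodReductionAt v ∧ Wd.HasGoodReductionAt v) ∨
      (((2 : ℕ) : 𝓞 K) ∉ v.asIdeal ∧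
        Nat.card (nsmulAddMonoidHom 2 : (W.baseChange (v.adicCompletion K)).toAffine.Point →+ _).ker = 1 ∧
        Nat.card (nsmulAddMonoidHom 2 : (Wd.baseChange (v.adicCompletion K)).toAffine.Point →+ _).ker = 1) ∨
      ((W.HasGoodReductionAt v ∨ (W.HasMultiplicativeReductionAt v ∧ Odd (W.ordMinimalDiscriminant v))) ∧
        closureEmb (K := K) (v.adicCompletion K) (geomSqrt d) ∈ maxUnramified (v.adicCompletion K)))
    (hinf : ∀ w : InfinitePlace K, w ≠ w₀ →
      (∃ s : w.Completion, s ^ 2 = algebraMap K w.Completion d) ∨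
      ((∀ x : galoisCohomology (W.localGaloisModule w.Completion) 1, x = 0) ∧
        (∀ x : galoisCohomology (Wd.localGaloisModule w.Completion) 1, x = 0))) :
    ∀ v : Place K, v ≠ Sum.inl w₀ → 𝓐 v = W.kummerSelmerStructure ((2 : ℕ) : ℤ) v := by
  rintro (w | v) hv
  · exact transport_twist_agree_inl_of_menu W φ ψ hφψ hsplit 𝓐 h𝓐 w (hinf w fun h ↦ hv (by rw [h]))
  · exact transport_twist_agree_inr_of_menu₅ W φ ψ hφψ hsplit hunr 𝓐 h𝓐 v (hfin v)

/-- **Agreement of `φ_* 𝓚_{Wd}` with `𝓚_W` OFF ONE FINITE PLACE `v₀`, from the FIVE-row finite menu** at every finite `v ≠ v₀` and the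
two-row menu at every infinite place (the `hagree` input of the lineage's one-finite-`T`-place transfer laws, now with the unramified
semistable row available at `v ∣ 2`). [cite: MazurRubin2010, Lemma 2.9, Lemma 2.10 (i), (ii), (iii), (iv), (v)] -/
theorem transport_twist_agree_off_inr_of_menu₅ {Wd : WeierstrassCurve K} [Wd.IsElliptic] {d : K}
    (φ : (Wd.torsionGaloisModule ((2 : ℕ) : ℤ)).toContRepresentation →ⁱL
      (W.torsionGaloisModule ((2 : ℕ) : ℤ)).toContRepresentation)
    (ψ : (W.torsionGaloisModule ((2 : ℕ) : ℤ)).toContRepresentation →ⁱL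
      (Wd.torsionGaloisModule ((2 : ℕ) : ℤ)).toContRepresentation)
    (hφψ : ∀ b, φ (ψ b) = b)
    (hsplit : ∀ (E : Type) [Field E] [Algebra K E], (∃ s : E, s ^ 2 = algebraMap K E d) →
      (Wd.kummerLocalConditionAt ((2 : ℕ) : ℤ) E).map (galoisCohomology.map (φ.restrictField E) 1) =
        W.kummerLocalConditionAt ((2 : ℕ) : ℤ) E)
    (hunr : ∀ (v : HeightOneSpectrum (𝓞 K)),
      (W.HasGoodReductionAt v ∨ (W.HasMultiplicativeReductionAt v ∧ Odd (W.ordMinimalDiscriminant v))) →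
      closureEmb (K := K) (v.adicCompletion K) (geomSqrt d) ∈ maxUnramified (v.adicCompletion K) →
      (Wd.kummerLocalConditionAt ((2 : ℕ) : ℤ) (v.adicCompletion K)).map
          (galoisCohomology.map (φ.restrictField (v.adicCompletion K)) 1) =
        W.kummerLocalConditionAt ((2 : ℕ) : ℤ) (v.adicCompletion K))
    (𝓐 : SelmerStructure (W.torsionGaloisModule ((2 : ℕ) : ℤ)))
    (h𝓐 : ∀ v, 𝓐 v = (Wd.kummerSelmerStructure ((2 : ℕ) : ℤ) v).map
      (galoisCohomology.map (φ.restrictField (Place.Completion v)) 1))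
    (v₀ : HeightOneSpectrum (𝓞 K))
    (hfin : ∀ v : HeightOneSpectrum (𝓞 K), v ≠ v₀ →
      (∃ s : v.adicCompletion K, s ^ 2 = algebraMap K (v.adicCompletion K) d) ∨
      (((2 : ℕ) : 𝓞 K) ∉ v.asIdeal ∧
        ¬ 2 ∣ (W.baseChange (v.adicCompletion K)).localTamagawaNumber (v.adicCompletionIntegers K) ∧
        ¬ 2 ∣ (Wd.baseChange (v.adicCompletion K)).localTamagawaNumber (v.adicCompletionIntegers K)) ∨
      (((2 : ℕ) : 𝓞 K) ∉ v.asIdeal ∧ W.HasGoodReductionAt v ∧ Wd.HasGoodReductionAt v) ∨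
      (((2 : ℕ) : 𝓞 K) ∉ v.asIdeal ∧
        Nat.card (nsmulAddMonoidHom 2 : (W.baseChange (v.adicCompletion K)).toAffine.Point →+ _).ker = 1 ∧
        Nat.card (nsmulAddMonoidHom 2 : (Wd.baseChange (v.adicCompletion K)).toAffine.Point →+ _).ker = 1) ∨
      ((W.HasGoodReductionAt v ∨ (W.HasMultiplicativeReductionAt v ∧ Odd (W.ordMinimalDiscriminant v))) ∧
        closureEmb (K := K) (v.adicCompletion K) (geomSqrt d) ∈ maxUnramified (v.adicCompletion K)))
    (hinf : ∀ w : InfinitePlace K,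
      (∃ s : w.Completion, s ^ 2 = algebraMap K w.Completion d) ∨
      ((∀ x : galoisCohomology (W.localGaloisModule w.Completion) 1, x = 0) ∧
        (∀ x : galoisCohomology (Wd.localGaloisModule w.Completion) 1, x = 0))) :
    ∀ v : Place K, v ≠ Sum.inr v₀ → 𝓐 v = W.kummerSelmerStructure ((2 : ℕ) : ℤ) v := by
  rintro (w | v) hv
  · exact transport_twist_agree_inl_of_menu W φ ψ hφψ hsplit 𝓐 h𝓐 w (hinf w)
  · exact transport_twist_agree_inr_of_menu₅ W φ ψ hφψ hsplit hunr 𝓐 h𝓐 v (hfin v fun h ↦ hv (by rw [h]))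

end Agree

/-! ## §99 Cor. 3.4 (i) with a single REAL `T`-place from the five-row finite menu — unconditional -/

section RealPlace

variable {K : Type} [Field K] [NumberField K] (W : WeierstrassCurve K) [W.IsElliptic]

/-- **Cor. 3.4 (i) DOWN with `T = {w₀}` a real place, FIVE-row finite menu — UNCONDITIONAL.** `W/K` elliptic over a number field,
`Wd = C • W^{(d)}` elliptic, `w₀` real with `w₀(Δ_W) > 0` and `d ∉ K_{w₀}²`, every finite place on the five-row menu (§98), every other
infinite place split or `H¹ = 0` for both: if some class of `Sel₂(W)` is non-trivial at `w₀` then `#Sel₂(Wd)·2 = #Sel₂(W)`. The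
identification is §97's master datum; PT and Tate χ are the tree theorems.
[cite: MazurRubin2010, Lemma 2.9, Prop. 3.3, Cor. 3.4 (i)] [cite: Kramer1981, §2 Prop. 6] [cite: MilneADT2006, I Thm. 2.13, 4.10] -/
theorem natCard_selmerGroup_twist_mul_two_eq_of_menu₅_inl {d : K} (hd : d ≠ 0) {Wd : WeierstrassCurve K} [Wd.IsElliptic]
    {C : VariableChange K} (hWd : C • W.quadraticTwist d = Wd)
    {w₀ : InfinitePlace K} (hw₀ : w₀.IsReal) (hΔ : 0 < InfinitePlace.embedding_of_isReal hw₀ W.Δ)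
    (hdsq₀ : ∀ s : w₀.Completion, s ^ 2 ≠ algebraMap K w₀.Completion d)
    (hfin : ∀ v : HeightOneSpectrum (𝓞 K),
      (∃ s : v.adicCompletion K, s ^ 2 = algebraMap K (v.adicCompletion K) d) ∨
      (((2 : ℕ) : 𝓞 K) ∉ v.asIdeal ∧
        ¬ 2 ∣ (W.baseChange (v.adicCompletion K)).localTamagawaNumber (v.adicCompletionIntegers K) ∧
        ¬ 2 ∣ (Wd.baseChange (v.adicCompletion K)).localTamagawaNumber (v.adicCompletionIntegers K)) ∨
      (((2 : ℕ) : 𝓞 K) ∉ v.asIdeal ∧ W.HasGoodReductionAt v ∧ Wd.HasGoodReductionAt v) ∨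
      (((2 : ℕ) : 𝓞 K) ∉ v.asIdeal ∧
        Nat.card (nsmulAddMonoidHom 2 : (W.baseChange (v.adicCompletion K)).toAffine.Point →+ _).ker = 1 ∧
        Nat.card (nsmulAddMonoidHom 2 : (Wd.baseChange (v.adicCompletion K)).toAffine.Point →+ _).ker = 1) ∨
      ((W.HasGoodReductionAt v ∨ (W.HasMultiplicativeReductionAt v ∧ Odd (W.ordMinimalDiscriminant v))) ∧
        closureEmb (K := K) (v.adicCompletion K) (geomSqrt d) ∈ maxUnramified (v.adicCompletion K)))
    (hinf : ∀ w : InfinitePlace K, w ≠ w₀ →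
      (∃ s : w.Completion, s ^ 2 = algebraMap K w.Completion d) ∨
      ((∀ x : galoisCohomology (W.localGaloisModule w.Completion) 1, x = 0) ∧
        (∀ x : galoisCohomology (Wd.localGaloisModule w.Completion) 1, x = 0)))
    (hns : ∃ c ∈ (W.kummerSelmerStructure ((2 : ℕ) : ℤ)).selmerGroup,
      galoisCohomology.localization (W.torsionGaloisModule ((2 : ℕ) : ℤ)) (Sum.inl w₀) 1 c ≠ 0) :
    Nat.card (Wd.selmerGroup ((2 : ℕ) : ℤ)) * 2 = Nat.card (W.selmerGroup ((2 : ℕ) : ℤ)) := by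
  haveI : Fact (Nat.Prime 2) := ⟨Nat.prime_two⟩
  have hEP : ∀ v : HeightOneSpectrum (𝓞 K), localEulerPoincareCharacteristic (v.adicCompletion K) := fun v ↦
    haveI : CharZero (v.adicCompletion K) := charZero_of_injective_algebraMap (algebraMap K _).injective
    localEulerPoincareCharacteristic_holds (v.adicCompletion K)
  obtain ⟨φ, ψ, hψφ, hφψ, hsplit, hunr, -, hreal, -⟩ := exists_intertwining_master_frame W Wd hd hWd
  let 𝓐 : SelmerStructure (W.torsionGaloisModule ((2 : ℕ) : ℤ)) := fun v ↦
    (Wd.kummerSelmerStructure ((2 : ℕ) : ℤ) v).map (galoisCohomology.map (φ.restrictField (Place.Completion v)) 1)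
  have h𝓐 : ∀ v, 𝓐 v = (Wd.kummerSelmerStructure ((2 : ℕ) : ℤ) v).map
      (galoisCohomology.map (φ.restrictField (Place.Completion v)) 1) := fun _ ↦ rfl
  have hagree := transport_twist_agree_off_inl_of_menu₅ W φ ψ hφψ hsplit hunr 𝓐 h𝓐 w₀ hfin hinf
  have htr' : 𝓐 (Sum.inl w₀) ⊓ W.kummerSelmerStructure ((2 : ℕ) : ℤ) (Sum.inl w₀) = ⊥ := by
    rw [h𝓐, kummerSelmerStructure_apply, kummerSelmerStructure_apply]
    exact hreal w₀ hw₀ hΔ hdsq₀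
  exact natCard_selmerGroup_mul_eq_of_transverse_inl_of_localization_ne_zero W Wd 2
    (poitouTate_selmerStructure_duality_real_holds (K := K)) hEP φ ψ hψφ hφψ 𝓐 h𝓐 w₀ hagree htr'
    (natCard_kummerSelmerStructure_inl_eq_two_of_isReal W hw₀ hΔ) hns

/-- **Cor. 3.4 (i) UP with `T = {w₀}` a real place, FIVE-row finite menu — UNCONDITIONAL.** Same data; if `Sel₂(W)` is strict at `w₀`
then `#Sel₂(Wd) = #Sel₂(W)·2`. The parity of the pair at `S = {w₀}` is Kramer's congruence for the FRAMED identification of §97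
(`GenusKolyKramer.isSquare_card_selmerGroup_mul_of_frame`, all inputs tree theorems); no `ρ̄_{W,2}`-onto, no «`d ∉ K²`».
[cite: MazurRubin2010, Thm. 2.7, Lemma 2.9, Prop. 3.3, Cor. 3.4 (i)] [cite: Kramer1981, §2 Prop. 6, Thm. 1] [cite: MilneADT2006, I Thm. 2.13, 4.10] -/
theorem natCard_selmerGroup_twist_eq_mul_two_of_menu₅_inl {d : K} (hd : d ≠ 0) {Wd : WeierstrassCurve K} [Wd.IsElliptic]
    {C : VariableChange K} (hWd : C • W.quadraticTwist d = Wd)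
    {w₀ : InfinitePlace K} (hw₀ : w₀.IsReal) (hΔ : 0 < InfinitePlace.embedding_of_isReal hw₀ W.Δ)
    (hdsq₀ : ∀ s : w₀.Completion, s ^ 2 ≠ algebraMap K w₀.Completion d)
    (hfin : ∀ v : HeightOneSpectrum (𝓞 K),
      (∃ s : v.adicCompletion K, s ^ 2 = algebraMap K (v.adicCompletion K) d) ∨
      (((2 : ℕ) : 𝓞 K) ∉ v.asIdeal ∧
        ¬ 2 ∣ (W.baseChange (v.adicCompletion K)).localTamagawaNumber (v.adicCompletionIntegers K) ∧
        ¬ 2 ∣ (Wd.baseChange (v.adicCompletion K)).localTamagawaNumber (v.adicCompletionIntegers K)) ∨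
      (((2 : ℕ) : 𝓞 K) ∉ v.asIdeal ∧ W.HasGoodReductionAt v ∧ Wd.HasGoodReductionAt v) ∨
      (((2 : ℕ) : 𝓞 K) ∉ v.asIdeal ∧
        Nat.card (nsmulAddMonoidHom 2 : (W.baseChange (v.adicCompletion K)).toAffine.Point →+ _).ker = 1 ∧
        Nat.card (nsmulAddMonoidHom 2 : (Wd.baseChange (v.adicCompletion K)).toAffine.Point →+ _).ker = 1) ∨
      ((W.HasGoodReductionAt v ∨ (W.HasMultiplicativeReductionAt v ∧ Odd (W.ordMinimalDiscriminant v))) ∧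
        closureEmb (K := K) (v.adicCompletion K) (geomSqrt d) ∈ maxUnramified (v.adicCompletion K)))
    (hinf : ∀ w : InfinitePlace K, w ≠ w₀ →
      (∃ s : w.Completion, s ^ 2 = algebraMap K w.Completion d) ∨
      ((∀ x : galoisCohomology (W.localGaloisModule w.Completion) 1, x = 0) ∧
        (∀ x : galoisCohomology (Wd.localGaloisModule w.Completion) 1, x = 0)))
    (hstrict : ∀ c ∈ (W.kummerSelmerStructure ((2 : ℕ) : ℤ)).selmerGroup,
      galoisCohomology.localization (W.torsionGaloisModule ((2 : ℕ) : ℤ)) (Sum.inl w₀) 1 c = 0) :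
    Nat.card (Wd.selmerGroup ((2 : ℕ) : ℤ)) = Nat.card (W.selmerGroup ((2 : ℕ) : ℤ)) * 2 := by
  haveI : Fact (Nat.Prime 2) := ⟨Nat.prime_two⟩
  have hEP : ∀ v : HeightOneSpectrum (𝓞 K), localEulerPoincareCharacteristic (v.adicCompletion K) := fun v ↦
    haveI : CharZero (v.adicCompletion K) := charZero_of_injective_algebraMap (algebraMap K _).injective
    localEulerPoincareCharacteristic_holds (v.adicCompletion K)
  obtain ⟨φ, ψ, hψφ, hφψ, hsplit, hunr, -, hreal, π, A, hπ, hA⟩ := exists_intertwining_master_frame W Wd hd hWd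
  let 𝓐 : SelmerStructure (W.torsionGaloisModule ((2 : ℕ) : ℤ)) := fun v ↦
    (Wd.kummerSelmerStructure ((2 : ℕ) : ℤ) v).map (galoisCohomology.map (φ.restrictField (Place.Completion v)) 1)
  have h𝓐 : ∀ v, 𝓐 v = (Wd.kummerSelmerStructure ((2 : ℕ) : ℤ) v).map
      (galoisCohomology.map (φ.restrictField (Place.Completion v)) 1) := fun _ ↦ rfl
  have hagree := transport_twist_agree_off_inl_of_menu₅ W φ ψ hφψ hsplit hunr 𝓐 h𝓐 w₀ hfin hinf
  have htr' : 𝓐 (Sum.inl w₀) ⊓ W.kummerSelmerStructure ((2 : ℕ) : ℤ) (Sum.inl w₀) = ⊥ := by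
    rw [h𝓐, kummerSelmerStructure_apply, kummerSelmerStructure_apply]
    exact hreal w₀ hw₀ hΔ hdsq₀
  -- the parity of the pair at `S = {w₀}`: Kramer's congruence for the FRAMED identification (part 9, unconditional)
  have hpar : IsSquare (Nat.card (Wd.selmerGroup ((2 : ℕ) : ℤ)) * Nat.card (W.selmerGroup ((2 : ℕ) : ℤ)) *
      (𝓐 (Sum.inl w₀)).relIndex (W.kummerSelmerStructure ((2 : ℕ) : ℤ) (Sum.inl w₀))) := by
    have hS : ∀ v ∉ ({(Sum.inl w₀ : Place K)} : Finset (Place K)), 𝓐 v = W.kummerSelmerStructure ((2 : ℕ) : ℤ) v :=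
      fun v hv ↦ hagree v (by simpa using hv)
    have h := GenusKolyKramer.isSquare_card_selmerGroup_mul_of_frame W Wd φ (Function.LeftInverse.injective hψφ) π hπ A hA
      𝓐 h𝓐 {(Sum.inl w₀ : Place K)} hS
    rwa [Finset.prod_singleton] at h
  exact natCard_selmerGroup_eq_mul_of_transverse_inl_of_forall_localization_eq_zero W Wd 2
    (poitouTate_selmerStructure_duality_real_holds (K := K)) hEP φ ψ hψφ hφψ 𝓐 h𝓐 w₀ hagree htr'
    (natCard_kummerSelmerStructure_inl_eq_two_of_isReal W hw₀ hΔ) hstrict hpar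

/-- **THE T-A DICHOTOMY with `T = {w₀}` a real place, FIVE-row finite menu — UNCONDITIONAL kernel theorem.** `W/K` elliptic over a
number field, `Wd = C • W^{(d)}` elliptic, `w₀` real with `w₀(Δ_W) > 0` at which `d` is not a square, every finite place on the menu
{split | `v ∤ 2` Tamagawa-odd both | `v ∤ 2` good both | `v ∤ 2` silent both | UNRAMIFIED in `K(√d)` with `W` good or multiplicative-odd
(any residue characteristic, `v ∣ 2` included)}, every other infinite place split or `H¹ = 0` for both: then `#Sel₂(Wd)·2 = #Sel₂(W)`
(some Selmer class of `W` non-trivial at `w₀`) or `#Sel₂(Wd) = #Sel₂(W)·2` (`Sel₂(W)` strict at `w₀`). Compared with gk2-p4's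
`natCard_selmerGroup_twist_shift_of_places_inl_frame` (§72): two more finite rows (Tamagawa-odd; unramified semistable at any `v`).
[cite: MazurRubin2010, Thm. 2.7, Lemmas 2.9–2.10, Prop. 3.3, Cor. 3.4 (i)] [cite: Kramer1981, §2 Props. 1, 2 (a), 3, 6, Thm. 1]
[cite: MilneADT2006, I Thm. 2.8, 2.13, 4.10] -/
theorem natCard_selmerGroup_twist_shift_of_menu₅_inl {d : K} (hd : d ≠ 0) {Wd : WeierstrassCurve K} [Wd.IsElliptic]
    {C : VariableChange K} (hWd : C • W.quadraticTwist d = Wd)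
    {w₀ : InfinitePlace K} (hw₀ : w₀.IsReal) (hΔ : 0 < InfinitePlace.embedding_of_isReal hw₀ W.Δ)
    (hdsq₀ : ∀ s : w₀.Completion, s ^ 2 ≠ algebraMap K w₀.Completion d)
    (hfin : ∀ v : HeightOneSpectrum (𝓞 K),
      (∃ s : v.adicCompletion K, s ^ 2 = algebraMap K (v.adicCompletion K) d) ∨
      (((2 : ℕ) : 𝓞 K) ∉ v.asIdeal ∧
        ¬ 2 ∣ (W.baseChange (v.adicCompletion K)).localTamagawaNumber (v.adicCompletionIntegers K) ∧
        ¬ 2 ∣ (Wd.baseChange (v.adicCompletion K)).localTamagawaNumber (v.adicCompletionIntegers K)) ∨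
      (((2 : ℕ) : 𝓞 K) ∉ v.asIdeal ∧ W.HasGoodReductionAt v ∧ Wd.HasGoodReductionAt v) ∨
      (((2 : ℕ) : 𝓞 K) ∉ v.asIdeal ∧
        Nat.card (nsmulAddMonoidHom 2 : (W.baseChange (v.adicCompletion K)).toAffine.Point →+ _).ker = 1 ∧
        Nat.card (nsmulAddMonoidHom 2 : (Wd.baseChange (v.adicCompletion K)).toAffine.Point →+ _).ker = 1) ∨
      ((W.HasGoodReductionAt v ∨ (W.HasMultiplicativeReductionAt v ∧ Odd (W.ordMinimalDiscriminant v))) ∧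
        closureEmb (K := K) (v.adicCompletion K) (geomSqrt d) ∈ maxUnramified (v.adicCompletion K)))
    (hinf : ∀ w : InfinitePlace K, w ≠ w₀ →
      (∃ s : w.Completion, s ^ 2 = algebraMap K w.Completion d) ∨
      ((∀ x : galoisCohomology (W.localGaloisModule w.Completion) 1, x = 0) ∧
        (∀ x : galoisCohomology (Wd.localGaloisModule w.Completion) 1, x = 0))) :
    Nat.card (Wd.selmerGroup ((2 : ℕ) : ℤ)) * 2 = Nat.card (W.selmerGroup ((2 : ℕ) : ℤ)) ∨
      Nat.card (Wd.selmerGroup ((2 : ℕ) : ℤ)) = Nat.card (W.selmerGroup ((2 : ℕ) : ℤ)) * 2 := by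
  by_cases hstrict : ∀ c ∈ (W.kummerSelmerStructure ((2 : ℕ) : ℤ)).selmerGroup,
      galoisCohomology.localization (W.torsionGaloisModule ((2 : ℕ) : ℤ)) (Sum.inl w₀) 1 c = 0
  · exact Or.inr (natCard_selmerGroup_twist_eq_mul_two_of_menu₅_inl W hd hWd hw₀ hΔ hdsq₀ hfin hinf hstrict)
  · push Not at hstrict
    obtain ⟨c, hc, hne⟩ := hstrict
    exact Or.inl (natCard_selmerGroup_twist_mul_two_eq_of_menu₅_inl W hd hWd hw₀ hΔ hdsq₀ hfin hinf ⟨c, hc, hne⟩)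

end RealPlace

end Summit.BirchSwinnertonDyer.BirchSwinnertonDyer.Theorems.GenusKolyArch

end
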